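import Mathlib
import HarnessLib
import Summits.ValiantsHypothesis.ValiantsHypothesis.Theses.MonotoneRestoration

/-! # Route MonotoneRestoration — crux `MonotoneRestorationQP`, line Sketch, stub Z6
(stmt-ValiantsHypothesis-15886)

**Vandermonde extraction of homogeneous components (pure algebra).** Over a field `K`, for a
multivariate polynomial `f` of total degree `≤ d` and `d + 1` pairwise distinct scalars
`t₀, …, t_d`, the `k`-th homogeneous component of `f` is the linear combination
`Σ_j (V⁻¹)_{k j} · f(t_j · x)` of the scaled copies `f(t_j · x)` of `f`, where `V = (t_j ^ i)_{j i}`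
is the Vandermonde matrix `Matrix.vandermonde t`.

Proof: the scaling identity `f(c · x) = Σ_{i ≤ d} c ^ i · f⁽ⁱ⁾` (`f⁽ⁱ⁾ = homogeneousComponent i f`,
checked on monomials: `x ↦ c · x` multiplies `monomial s a` by `c ^ |s|`), followed by
`V⁻¹ * V = 1` (`Matrix.nonsing_inv_mul`, the determinant being nonzero by
`Matrix.det_vandermonde_ne_zero_iff`). This is the interpolation identity behind "symmetric
circuit size is closed under taking homogeneous components" (Strassen 1973 / folklore).
-/

set_option linter.dupNamespace false

namespace Summit.ValiantsHypothesis.ValiantsHypothesis.Theorems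

open MvPolynomial

namespace HomogeneousComponentVandermonde

/-! ## Scaling identities `φ(c · x) = Σ_i c ^ i · φ⁽ⁱ⁾` -/

/-- Scaling a monomial: the substitution `x ↦ c · x` multiplies `monomial s a` by `c ^ |s|`,
`|s| = Σ_i s i` the degree of the exponent vector. [folklore] -/
theorem aeval_C_mul_X_monomial {K σ : Type} [CommSemiring K] (c : K) (s : σ →₀ ℕ) (a : K) :
    MvPolynomial.aeval (fun x : σ => C c * X x) (monomial s a) =
      c ^ (∑ i ∈ s.support, s i) • monomial s a := by
  rw [aeval_monomial, algebraMap_eq, smul_eq_C_mul, monomial_eq]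
  simp_rw [mul_pow]
  rw [Finsupp.prod_mul, Finsupp.prod, Finset.prod_pow_eq_pow_sum, ← C_pow]
  ring

/-- Scaling a homogeneous polynomial: if `φ` is homogeneous of degree `n` then the substitution
`x ↦ c · x` multiplies `φ` by `c ^ n`. [folklore] -/
theorem aeval_C_mul_X_of_isHomogeneous {K σ : Type} [CommSemiring K] {φ : MvPolynomial σ K}
    {n : ℕ} (hφ : φ.IsHomogeneous n) (c : K) :
    MvPolynomial.aeval (fun x : σ => C c * X x) φ = c ^ n • φ := by
  -- cf. `Summit.ValiantsHypothesis.ValiantsHypothesis.Theorems.ChowBorderBound.Interpolate.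
  --   aeval_C_mul_X_of_isHomogeneous` (same computation in the `C (t ^ d) * ψ` form; not imported,
  --   to stay inside this route's import cone).
  conv_lhs => rw [φ.as_sum, map_sum]
  conv_rhs => rw [φ.as_sum, Finset.smul_sum]
  refine Finset.sum_congr rfl fun s hs => ?_
  rw [aeval_C_mul_X_monomial, ← hφ.degree_eq_sum_deg_support hs]

/-- The scaling identity: for `f` of total degree `≤ d`,
`f(c · x) = Σ_{i ≤ d} c ^ i · homogeneousComponent i f`. [folklore] -/
theorem aeval_C_mul_X_eq_sum_homogeneousComponent {K σ : Type} [CommRing K] {d : ℕ}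
    (f : MvPolynomial σ K) (hf : f.totalDegree ≤ d) (c : K) :
    MvPolynomial.aeval (fun x : σ => C c * X x) f =
      ∑ i : Fin (d + 1), c ^ (i : ℕ) • homogeneousComponent i f := by
  rw [Fin.sum_univ_eq_sum_range (fun i => c ^ i • homogeneousComponent i f) (d + 1),
    ← Finset.sum_subset (Finset.range_subset_range.2 (Nat.succ_le_succ hf))
      (fun i _ hi => by
        rw [homogeneousComponent_eq_zero i f
          (Nat.lt_of_succ_le (not_lt.1 (fun h => hi (Finset.mem_range.2 h)))), smul_zero])]
  conv_lhs => rw [← sum_homogeneousComponent f, map_sum]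
  refine Finset.sum_congr rfl fun i _ => ?_
  exact aeval_C_mul_X_of_isHomogeneous (homogeneousComponent_isHomogeneous i f) c

end HomogeneousComponentVandermonde

open HomogeneousComponentVandermonde in
/-- **Z6 — VANDERMONDE EXTRACTION OF HOMOGENEOUS COMPONENTS (pure algebra).** Over a field, for a
polynomial `f` of total degree `≤ d` and `d + 1` distinct scalars `t_0, …, t_d`, the `k`-th
homogeneous component of `f` is the linear combination `Σ_j (V⁻¹)_{k j} · f(t_j · x)` of the scaled
copies of `f`, `V = (t_j^i)` the Vandermonde matrix: `f(t · x) = Σ_i t^i f^{(i)}` and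
`V⁻¹ V = 1`. The identity behind "symmetric circuit size is closed under homogeneous components"
(interpolation; Strassen 1973 / folklore). Crux `MonotoneRestorationQP`, line Sketch, registered
stub `stub_homogeneousComponent_vandermonde`. [folklore] -/
theorem stub_homogeneousComponent_vandermonde {K σ : Type} [Field K] {d : ℕ}
    (f : MvPolynomial σ K) (hf : f.totalDegree ≤ d) (t : Fin (d + 1) → K)
    (ht : Function.Injective t) (k : Fin (d + 1)) :
    ∑ j : Fin (d + 1), (Matrix.vandermonde t)⁻¹ k j •
        MvPolynomial.aeval (fun x : σ => MvPolynomial.C (t j) * MvPolynomial.X x) f =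
      MvPolynomial.homogeneousComponent k f := by
  have hV : (Matrix.vandermonde t)⁻¹ * Matrix.vandermonde t = 1 :=
    Matrix.nonsing_inv_mul _ (isUnit_iff_ne_zero.2 (Matrix.det_vandermonde_ne_zero_iff.2 ht))
  simp_rw [aeval_C_mul_X_eq_sum_homogeneousComponent f hf, Finset.smul_sum, smul_smul]
  rw [Finset.sum_comm]
  simp_rw [← Finset.sum_smul, ← Matrix.vandermonde_apply t, ← Matrix.mul_apply, hV,
    Matrix.one_apply, ite_smul, one_smul, zero_smul, Finset.sum_ite_eq, Finset.mem_univ, if_true]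

end Summit.ValiantsHypothesis.ValiantsHypothesis.Theorems
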